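import Mathlib
import Literature.MathematicalPhysics.QuantumLattice.GrassmannIntegralProofs
import HarnessLib

/-!
# Stub `stub_diracKato` of line `zero-mode-floor-dilute-gas`
(crux `Summit.QuantumFields.QCD.Theses.NestedDissectionSea.EarlyCrosserLaw`,
item stmt-QuantumFields-13995)

## What is proved

The pointwise **Dirac–Kato inequality** with constant `4/5`, in pure finite-dimensional form.
Spinor–colour vectors are `4 × 3` complex matrices `u : Fin 4 → Fin 3 → ℂ` (spinor index
first), the Euclidean gamma matrices `γ_μ = euclideanGamma μ` act on the spinor index by matrix
multiplication, and the pairing is `⟨u, w⟩ = Σ_{s,c} conj (u s c) * w s c` (conjugate-linear in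
the first slot), `‖u‖² = Σ ‖u s c‖²`.  If `v_0, …, v_3` satisfy the Dirac relation
`Σ_μ γ_μ v_μ = 0`, then for every `u`

  `Σ_μ (Re⟨u, v_μ⟩)² ≤ (4/5) ‖u‖² Σ_μ ‖v_μ‖²`.

(Applied to `u = ψ(x)`, `v_μ = ∇_μ ψ(x)` this is Kato's inequality `|d|ψ||² ≤ (4/5)|∇ψ|²`
for Dirac-harmonic spinors; the sharp constant is `3/4`, not needed.)

## Proof

Write `⟪x, y⟫ = Re tr (xᴴ y)` for the real Frobenius pairing (in the Lean text it is spelled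
out as `(xᴴ * y).trace.re`), `N = ⟪u, u⟫`, `a_μ = ⟪u, v_μ⟫`, `A = Σ a_μ²`,
`G = Σ_μ a_μ γ_μ` (real coefficients, so `Gᴴ = G`).  The Clifford relations
`euclideanGamma_anticomm_holds` give `γ_ν G + G γ_ν = 2 a_ν` and hence `G² = A`.
* Pairing `G u` with the Dirac relation:
  `0 = Σ_ν ⟪G u, γ_ν v_ν⟫ = Σ_ν ⟪γ_ν G u, v_ν⟫ = Σ_ν ⟪2 a_ν u − G γ_ν u, v_ν⟫`
  `= 2A − Σ_ν ⟪G γ_ν u, v_ν⟫`.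
* `⟪G γ_ν u, u⟫ = a_ν N` (average of `G γ_ν` and `γ_ν G`), and `‖G γ_ν u‖² = A N`
  (`G² = A`, `γ_ν² = 1`).
* With `w_ν = N v_ν − a_ν u` (the part of `v_ν` Re-orthogonal to `u`, scaled by `N` to
  avoid division): `Σ_ν ⟪G γ_ν u, w_ν⟫ = 2AN − AN = AN` and
  `Σ_ν ‖w_ν‖² = N² Σ_ν ‖v_ν‖² − N A`.
* Young's inequality `⟪x, y⟫ ≤ ‖x‖²/8 + 2‖y‖²` termwise:
  `AN ≤ 4·AN/8 + 2(N² Σ‖v_ν‖² − NA)`, i.e. `5 A N ≤ 4 N² Σ_ν ‖v_ν‖²`; divide by `N > 0`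
  (if `N = 0` then `u = 0` and both sides vanish).

Mathlib only, plus the tree facts `euclideanGamma`, `euclideanGamma_anticomm_holds`,
`euclideanGamma_mul_self`, `euclideanGamma_isHermitian`.
-/

noncomputable section

open scoped BigOperators Matrix ComplexConjugate
open Literature.MathematicalPhysics.QuantumLattice

namespace Summit.QuantumFields.QCD.Cruxes.EarlyCrosserLaw.ZeroModeFloorDiluteGas

/-! ### The real Frobenius pairing `(xᴴ * y).trace.re` -/

/-- The raw double sum `Σ_{s,c} conj (x s c) * y s c` is the trace form `tr (xᴴ y)`. -/
theorem diracKato_sum_eq_trace (x y : Matrix (Fin 4) (Fin 3) ℂ) :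
    ∑ s, ∑ c, conj (x s c) * y s c = (xᴴ * y).trace := by
  simp only [Matrix.trace, Matrix.diag_apply, Matrix.mul_apply, Matrix.conjTranspose_apply,
    Complex.star_def]
  exact Finset.sum_comm

/-- `⟪x, x⟫ = Σ ‖x s c‖²`. -/
theorem diracKato_ip_self (x : Matrix (Fin 4) (Fin 3) ℂ) :
    (xᴴ * x).trace.re = ∑ s, ∑ c, ‖x s c‖ ^ 2 := by
  rw [← diracKato_sum_eq_trace]
  simp only [Complex.conj_mul', ← Complex.ofReal_pow, ← Complex.ofReal_sum, Complex.ofReal_re]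

/-- `0 ≤ ⟪x, x⟫`. -/
theorem diracKato_ip_self_nonneg (x : Matrix (Fin 4) (Fin 3) ℂ) : 0 ≤ (xᴴ * x).trace.re := by
  rw [diracKato_ip_self]
  positivity

/-- Symmetry of the real pairing. -/
theorem diracKato_ip_comm (x y : Matrix (Fin 4) (Fin 3) ℂ) :
    (xᴴ * y).trace.re = (yᴴ * x).trace.re := by
  have h : yᴴ * x = (xᴴ * y)ᴴ := by
    rw [Matrix.conjTranspose_mul, Matrix.conjTranspose_conjTranspose]
  rw [h, Matrix.trace_conjTranspose, Complex.star_def, Complex.conj_re]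

/-- Adjoint rule: a matrix acting on the first slot moves to its conjugate transpose on the
second slot. -/
theorem diracKato_ip_mul_left (M : Matrix (Fin 4) (Fin 4) ℂ) (x y : Matrix (Fin 4) (Fin 3) ℂ) :
    ((M * x)ᴴ * y).trace.re = (xᴴ * (Mᴴ * y)).trace.re := by
  rw [Matrix.conjTranspose_mul, Matrix.mul_assoc]

/-- Additivity in the second slot. -/
theorem diracKato_ip_add_right (x y z : Matrix (Fin 4) (Fin 3) ℂ) :
    (xᴴ * (y + z)).trace.re = (xᴴ * y).trace.re + (xᴴ * z).trace.re := by
  rw [Matrix.mul_add, Matrix.trace_add, Complex.add_re]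

/-- Additivity in the first slot. -/
theorem diracKato_ip_add_left (x y z : Matrix (Fin 4) (Fin 3) ℂ) :
    ((x + y)ᴴ * z).trace.re = (xᴴ * z).trace.re + (yᴴ * z).trace.re := by
  rw [Matrix.conjTranspose_add, Matrix.add_mul, Matrix.trace_add, Complex.add_re]

/-- Subtraction in the second slot. -/
theorem diracKato_ip_sub_right (x y z : Matrix (Fin 4) (Fin 3) ℂ) :
    (xᴴ * (y - z)).trace.re = (xᴴ * y).trace.re - (xᴴ * z).trace.re := by
  rw [Matrix.mul_sub, Matrix.trace_sub, Complex.sub_re]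

/-- Subtraction in the first slot. -/
theorem diracKato_ip_sub_left (x y z : Matrix (Fin 4) (Fin 3) ℂ) :
    ((x - y)ᴴ * z).trace.re = (xᴴ * z).trace.re - (yᴴ * z).trace.re := by
  rw [Matrix.conjTranspose_sub, Matrix.sub_mul, Matrix.trace_sub, Complex.sub_re]

/-- Real scalars in the second slot. -/
theorem diracKato_ip_smul_right (r : ℝ) (x y : Matrix (Fin 4) (Fin 3) ℂ) :
    (xᴴ * ((r : ℂ) • y)).trace.re = r * (xᴴ * y).trace.re := by
  rw [Matrix.mul_smul, Matrix.trace_smul, smul_eq_mul, Complex.re_ofReal_mul]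

/-- Real scalars in the first slot. -/
theorem diracKato_ip_smul_left (r : ℝ) (x y : Matrix (Fin 4) (Fin 3) ℂ) :
    (((r : ℂ) • x)ᴴ * y).trace.re = r * (xᴴ * y).trace.re := by
  rw [diracKato_ip_comm ((r : ℂ) • x) y, diracKato_ip_smul_right, diracKato_ip_comm y x]

/-- Young's inequality for the real pairing: `⟪x, y⟫ ≤ ‖x‖²/8 + 2‖y‖²`
(from `0 ≤ ‖x − 4y‖²`). -/
theorem diracKato_young (x y : Matrix (Fin 4) (Fin 3) ℂ) :
    (xᴴ * y).trace.re ≤ (xᴴ * x).trace.re / 8 + 2 * (yᴴ * y).trace.re := by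
  have h := diracKato_ip_self_nonneg (x - ((4 : ℝ) : ℂ) • y)
  rw [diracKato_ip_sub_right, diracKato_ip_sub_left, diracKato_ip_sub_left,
    diracKato_ip_smul_right, diracKato_ip_smul_right, diracKato_ip_smul_left,
    diracKato_ip_smul_left, diracKato_ip_comm y x] at h
  linarith

/-! ### Clifford algebra of `G = Σ_μ a_μ γ_μ` with real coefficients -/

/-- Linearised Clifford relation: `γ_ν G + G γ_ν = 2 a_ν · 1` for `G = Σ_μ a_μ γ_μ`. -/
theorem diracKato_anticomm_sum (a : Fin 4 → ℝ) (ν : Fin 4) :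
    euclideanGamma ν * (∑ μ, (a μ : ℂ) • euclideanGamma μ) +
        (∑ μ, (a μ : ℂ) • euclideanGamma μ) * euclideanGamma ν =
      ((2 * a ν : ℝ) : ℂ) • (1 : Matrix (Fin 4) (Fin 4) ℂ) := by
  rw [Matrix.mul_sum, Matrix.sum_mul, ← Finset.sum_add_distrib]
  have h : ∀ μ, euclideanGamma ν * ((a μ : ℂ) • euclideanGamma μ) +
      (a μ : ℂ) • euclideanGamma μ * euclideanGamma ν =
      (a μ : ℂ) • (if μ = ν then (2 : Matrix (Fin 4) (Fin 4) ℂ) else 0) := by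
    intro μ
    rw [Matrix.mul_smul, Matrix.smul_mul, ← smul_add, add_comm,
      euclideanGamma_anticomm_holds μ ν]
  simp_rw [h, smul_ite, smul_zero, Finset.sum_ite_eq', Finset.mem_univ, if_true]
  rw [← one_add_one_eq_two, smul_add, ← add_smul, Complex.ofReal_mul, Complex.ofReal_ofNat,
    two_mul]

/-- `G` is Hermitian: `Gᴴ = G` (real coefficients, Hermitian gamma matrices). -/
theorem diracKato_G_conjTranspose (a : Fin 4 → ℝ) :
    (∑ μ, (a μ : ℂ) • euclideanGamma μ)ᴴ = ∑ μ, (a μ : ℂ) • euclideanGamma μ := by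
  rw [Matrix.conjTranspose_sum]
  refine Finset.sum_congr rfl fun μ _ => ?_
  rw [Matrix.conjTranspose_smul, (euclideanGamma_isHermitian μ).eq, Complex.star_def,
    Complex.conj_ofReal]

/-- Clifford square: `G G = (Σ_μ a_μ²) · 1`. -/
theorem diracKato_G_mul_self (a : Fin 4 → ℝ) :
    (∑ μ, (a μ : ℂ) • euclideanGamma μ) * (∑ μ, (a μ : ℂ) • euclideanGamma μ) =
      ((∑ μ, a μ ^ 2 : ℝ) : ℂ) • (1 : Matrix (Fin 4) (Fin 4) ℂ) := by
  obtain ⟨G, hG⟩ : ∃ G : Matrix (Fin 4) (Fin 4) ℂ, G = ∑ μ, (a μ : ℂ) • euclideanGamma μ :=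
    ⟨_, rfl⟩
  have hAC : ∀ ν, euclideanGamma ν * G = ((2 * a ν : ℝ) : ℂ) • 1 - G * euclideanGamma ν :=
    fun ν => eq_sub_of_add_eq (by rw [hG]; exact diracKato_anticomm_sum a ν)
  -- `G G = Σ_ν a_ν (γ_ν G) = Σ_ν a_ν (2 a_ν - G γ_ν) = 2A - G G`
  have h1 : G * G = ((∑ μ, 2 * a μ ^ 2 : ℝ) : ℂ) • 1 - G * G := by
    calc G * G = (∑ ν, (a ν : ℂ) • euclideanGamma ν) * G := by rw [← hG]
      _ = ∑ ν, (a ν : ℂ) • (euclideanGamma ν * G) := by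
          rw [Matrix.sum_mul]
          exact Finset.sum_congr rfl fun ν _ => Matrix.smul_mul _ _ _
      _ = ∑ ν, ((a ν : ℂ) • (((2 * a ν : ℝ) : ℂ) • (1 : Matrix (Fin 4) (Fin 4) ℂ)) -
            (a ν : ℂ) • (G * euclideanGamma ν)) := by
          refine Finset.sum_congr rfl fun ν _ => ?_
          rw [hAC ν, smul_sub]
      _ = (∑ ν, ((2 * a ν ^ 2 : ℝ) : ℂ) • (1 : Matrix (Fin 4) (Fin 4) ℂ)) -
            ∑ ν, (a ν : ℂ) • (G * euclideanGamma ν) := by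
          rw [Finset.sum_sub_distrib]
          congr 1
          refine Finset.sum_congr rfl fun ν _ => ?_
          rw [smul_smul]
          congr 1
          push_cast
          ring
      _ = ((∑ μ, 2 * a μ ^ 2 : ℝ) : ℂ) • 1 - G * G := by
          rw [← Finset.sum_smul, ← Complex.ofReal_sum]
          congr 1
          rw [hG, Matrix.mul_sum]
          exact Finset.sum_congr rfl fun ν _ => (Matrix.mul_smul _ _ _).symm
  -- solve `X = c • 1 - X` for `X`
  have h2 : (2 : ℂ) • (G * G) =
      (2 : ℂ) • (((∑ μ, a μ ^ 2 : ℝ) : ℂ) • (1 : Matrix (Fin 4) (Fin 4) ℂ)) := by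
    rw [smul_smul, two_smul]
    nth_rewrite 1 [h1]
    rw [sub_add_cancel]
    congr 1
    push_cast
    rw [Finset.mul_sum]
  rw [hG] at h2
  exact smul_right_injective _ (two_ne_zero' ℂ) h2

/-! ### The inequality in trace form -/

/-- Core estimate, trace form: `5 · (Σ_μ ⟪u, v_μ⟫²) · ‖u‖² ≤ 4 · ‖u‖⁴ · Σ_μ ‖v_μ‖²` under the
Dirac relation `Σ_μ γ_μ v_μ = 0`. -/
theorem diracKato_core (u : Matrix (Fin 4) (Fin 3) ℂ) (v : Fin 4 → Matrix (Fin 4) (Fin 3) ℂ)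
    (hD : ∑ μ, euclideanGamma μ * v μ = 0) :
    5 * (∑ μ, (uᴴ * v μ).trace.re ^ 2) * (uᴴ * u).trace.re ≤
      4 * (uᴴ * u).trace.re ^ 2 * ∑ μ, ((v μ)ᴴ * v μ).trace.re := by
  obtain ⟨a, ha⟩ : ∃ a : Fin 4 → ℝ, ∀ μ, (uᴴ * v μ).trace.re = a μ :=
    ⟨fun μ => (uᴴ * v μ).trace.re, fun μ => rfl⟩
  obtain ⟨N, hN⟩ : ∃ N : ℝ, (uᴴ * u).trace.re = N := ⟨_, rfl⟩
  obtain ⟨G, hG⟩ : ∃ G : Matrix (Fin 4) (Fin 4) ℂ, G = ∑ μ, (a μ : ℂ) • euclideanGamma μ :=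
    ⟨_, rfl⟩
  simp_rw [ha]
  rw [hN]
  set A : ℝ := ∑ μ, a μ ^ 2 with hA
  set V : ℝ := ∑ μ, ((v μ)ᴴ * v μ).trace.re with hV
  -- matrix facts
  have hGG : G * G = (A : ℂ) • 1 := by rw [hG]; exact diracKato_G_mul_self a
  have hGH : Gᴴ = G := by rw [hG]; exact diracKato_G_conjTranspose a
  have hAC' : ∀ ν, euclideanGamma ν * G + G * euclideanGamma ν = ((2 * a ν : ℝ) : ℂ) • 1 :=
    fun ν => by rw [hG]; exact diracKato_anticomm_sum a ν
  have hAC : ∀ ν, euclideanGamma ν * G = ((2 * a ν : ℝ) : ℂ) • 1 - G * euclideanGamma ν :=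
    fun ν => eq_sub_of_add_eq (hAC' ν)
  have hγH : ∀ ν, (euclideanGamma ν)ᴴ = euclideanGamma ν :=
    fun ν => (euclideanGamma_isHermitian ν).eq
  -- (F2): pairing `G u` with the Dirac relation
  have hF2 : ∑ ν, ((G * euclideanGamma ν * u)ᴴ * v ν).trace.re = 2 * A := by
    have h0 : ((G * u)ᴴ * (∑ ν, euclideanGamma ν * v ν)).trace.re = 0 := by
      rw [hD, Matrix.mul_zero, Matrix.trace_zero, Complex.zero_re]
    have h1 : ((G * u)ᴴ * (∑ ν, euclideanGamma ν * v ν)).trace.re =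
        ∑ ν, ((G * u)ᴴ * (euclideanGamma ν * v ν)).trace.re := by
      rw [Matrix.mul_sum, Matrix.trace_sum, Complex.re_sum]
    have h2 : ∀ ν, ((G * u)ᴴ * (euclideanGamma ν * v ν)).trace.re =
        2 * a ν ^ 2 - ((G * euclideanGamma ν * u)ᴴ * v ν).trace.re := by
      intro ν
      have e : ((G * u)ᴴ * (euclideanGamma ν * v ν)).trace.re =
          ((euclideanGamma ν * (G * u))ᴴ * v ν).trace.re := by
        rw [diracKato_ip_mul_left (euclideanGamma ν), hγH]
      rw [e, ← Matrix.mul_assoc, hAC ν, Matrix.sub_mul, Matrix.smul_mul, Matrix.one_mul,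
        diracKato_ip_sub_left, diracKato_ip_smul_left, ha]
      ring
    rw [h1] at h0
    simp_rw [h2] at h0
    rw [Finset.sum_sub_distrib] at h0
    have h3 : ∑ ν, 2 * a ν ^ 2 = 2 * A := by rw [hA, Finset.mul_sum]
    linarith
  -- (F3): `⟪G γ_ν u, u⟫ = a_ν N`
  have hF3 : ∀ ν, ((G * euclideanGamma ν * u)ᴴ * u).trace.re = a ν * N := by
    intro ν
    have e1 : ((euclideanGamma ν * G * u)ᴴ * u).trace.re =
        ((G * euclideanGamma ν * u)ᴴ * u).trace.re := by
      rw [Matrix.mul_assoc, diracKato_ip_mul_left (euclideanGamma ν), hγH,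
        diracKato_ip_mul_left G, hGH, diracKato_ip_comm u, Matrix.mul_assoc]
    have e2 : ((euclideanGamma ν * G * u)ᴴ * u).trace.re +
        ((G * euclideanGamma ν * u)ᴴ * u).trace.re = 2 * a ν * N := by
      rw [← diracKato_ip_add_left, ← Matrix.add_mul, hAC' ν, Matrix.smul_mul, Matrix.one_mul,
        diracKato_ip_smul_left, hN]
    linarith
  -- (F4): `‖G γ_ν u‖² = A N`
  have hF4 : ∀ ν,
      ((G * euclideanGamma ν * u)ᴴ * (G * euclideanGamma ν * u)).trace.re = A * N := by
    intro ν
    rw [Matrix.mul_assoc, diracKato_ip_mul_left G, hGH, ← Matrix.mul_assoc G G, hGG,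
      Matrix.smul_mul, Matrix.one_mul, diracKato_ip_smul_right,
      diracKato_ip_mul_left (euclideanGamma ν), hγH,
      ← Matrix.mul_assoc (euclideanGamma ν) (euclideanGamma ν) u, euclideanGamma_mul_self,
      Matrix.one_mul, hN]
  -- the Re-orthogonal parts `w_ν = N v_ν - a_ν u`
  obtain ⟨w, hw⟩ : ∃ w : Fin 4 → Matrix (Fin 4) (Fin 3) ℂ,
      ∀ ν, w ν = (N : ℂ) • v ν - (a ν : ℂ) • u :=
    ⟨fun ν => (N : ℂ) • v ν - (a ν : ℂ) • u, fun ν => rfl⟩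
  -- (F5): `Σ_ν ⟪G γ_ν u, w_ν⟫ = A N`
  have hF5 : ∑ ν, ((G * euclideanGamma ν * u)ᴴ * w ν).trace.re = A * N := by
    have h : ∀ ν, ((G * euclideanGamma ν * u)ᴴ * w ν).trace.re =
        N * ((G * euclideanGamma ν * u)ᴴ * v ν).trace.re - a ν * (a ν * N) := by
      intro ν
      rw [hw, diracKato_ip_sub_right, diracKato_ip_smul_right, diracKato_ip_smul_right, hF3]
    simp_rw [h]
    rw [Finset.sum_sub_distrib, ← Finset.mul_sum, hF2]
    have h3 : ∑ ν, a ν * (a ν * N) = A * N := by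
      rw [hA, Finset.sum_mul]
      exact Finset.sum_congr rfl fun ν _ => by ring
    linarith
  -- (F6): `Σ_ν ‖w_ν‖² = N² V - N A`
  have hF6 : ∑ ν, ((w ν)ᴴ * w ν).trace.re = N ^ 2 * V - N * A := by
    have h : ∀ ν, ((w ν)ᴴ * w ν).trace.re =
        N ^ 2 * ((v ν)ᴴ * v ν).trace.re - N * a ν ^ 2 := by
      intro ν
      rw [hw, diracKato_ip_sub_right, diracKato_ip_sub_left, diracKato_ip_sub_left,
        diracKato_ip_smul_right, diracKato_ip_smul_right, diracKato_ip_smul_left,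
        diracKato_ip_smul_left, diracKato_ip_smul_left, diracKato_ip_smul_left,
        diracKato_ip_smul_right, diracKato_ip_smul_right, diracKato_ip_comm (v ν) u, ha, hN]
      ring
    simp_rw [h]
    rw [Finset.sum_sub_distrib, ← Finset.mul_sum, ← Finset.mul_sum]
  -- Young termwise, then sum over `ν`
  have hY : ∀ ν, ((G * euclideanGamma ν * u)ᴴ * w ν).trace.re ≤
      A * N / 8 + 2 * ((w ν)ᴴ * w ν).trace.re := by
    intro ν
    have h := diracKato_young (G * euclideanGamma ν * u) (w ν)
    rwa [hF4] at h
  have hsum := Finset.sum_le_sum fun ν (_ : ν ∈ Finset.univ) => hY ν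
  rw [hF5, Finset.sum_add_distrib, ← Finset.mul_sum, hF6] at hsum
  simp only [Finset.sum_const, Finset.card_univ, Fintype.card_fin, nsmul_eq_mul,
    Nat.cast_ofNat] at hsum
  linarith

/-- The Dirac–Kato inequality for matrix-typed arguments, in the raw-sum form of the stub. -/
theorem diracKato_matrix (u : Matrix (Fin 4) (Fin 3) ℂ) (v : Fin 4 → Matrix (Fin 4) (Fin 3) ℂ)
    (hD : ∀ s c, ∑ μ : Fin 4, ∑ s' : Fin 4, euclideanGamma μ s s' * v μ s' c = 0) :
    ∑ μ : Fin 4, (∑ s, ∑ c, starRingEnd ℂ (u s c) * v μ s c).re ^ 2 ≤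
      (4 / 5 : ℝ) * (∑ s, ∑ c, ‖u s c‖ ^ 2) * ∑ μ : Fin 4, ∑ s, ∑ c, ‖v μ s c‖ ^ 2 := by
  have hD' : ∑ μ, euclideanGamma μ * v μ = 0 := by
    ext s c
    simpa [Matrix.sum_apply, Matrix.mul_apply] using hD s c
  have hcore := diracKato_core u v hD'
  have e1 : ∀ μ, (∑ s, ∑ c, starRingEnd ℂ (u s c) * v μ s c).re = (uᴴ * v μ).trace.re :=
    fun μ => by rw [diracKato_sum_eq_trace u (v μ)]
  have e2 : ∑ s, ∑ c, ‖u s c‖ ^ 2 = (uᴴ * u).trace.re := (diracKato_ip_self u).symm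
  have e3 : ∀ μ, ∑ s, ∑ c, ‖v μ s c‖ ^ 2 = ((v μ)ᴴ * v μ).trace.re :=
    fun μ => (diracKato_ip_self (v μ)).symm
  simp only [e1, e2, e3]
  by_cases hN : (uᴴ * u).trace.re = 0
  · -- then `u = 0` and both sides vanish
    have hu : u = 0 := by
      rw [diracKato_ip_self] at hN
      ext s c
      have hs := (Finset.sum_eq_zero_iff_of_nonneg fun s _ =>
        Finset.sum_nonneg fun c _ => sq_nonneg ‖u s c‖).1 hN s (Finset.mem_univ s)
      have hc := (Finset.sum_eq_zero_iff_of_nonneg fun c _ => sq_nonneg ‖u s c‖).1 hs c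
        (Finset.mem_univ c)
      simpa using hc
    subst hu
    simp
  · have hNpos : 0 < (uᴴ * u).trace.re :=
      lt_of_le_of_ne (diracKato_ip_self_nonneg u) (Ne.symm hN)
    have hV : 0 ≤ ∑ μ, ((v μ)ᴴ * v μ).trace.re :=
      Finset.sum_nonneg fun μ _ => diracKato_ip_self_nonneg (v μ)
    nlinarith [hcore, hNpos, hV]

/-- **S2b `stub_diracKato` — the pointwise Dirac–Kato inequality with constant `4/5`.**
If `v_0, …, v_3 ∈ ℂ⁴ ⊗ ℂ³` satisfy the Dirac relation `Σ_μ (γ_μ ⊗ 1) v_μ = 0` then for every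
`u ∈ ℂ⁴ ⊗ ℂ³`: `Σ_μ (Re⟨u, v_μ⟩)² ≤ (4/5) ‖u‖² Σ_μ ‖v_μ‖²`
(registered signature of line `zero-mode-floor-dilute-gas`). -/
theorem stub_diracKato :
    ∀ (u : Fin 4 → Fin 3 → ℂ) (v : Fin 4 → Fin 4 → Fin 3 → ℂ), (∀ s c, ∑ μ : Fin 4, ∑ s' : Fin 4, euclideanGamma μ s s' * v μ s' c = 0) → ∑ μ : Fin 4, (∑ s, ∑ c, starRingEnd ℂ (u s c) * v μ s c).re ^ 2 ≤ (4 / 5 : ℝ) * (∑ s, ∑ c, ‖u s c‖ ^ 2) * ∑ μ : Fin 4, ∑ s, ∑ c, ‖v μ s c‖ ^ 2 := by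
  intro u v hD
  exact diracKato_matrix u v hD

end Summit.QuantumFields.QCD.Cruxes.EarlyCrosserLaw.ZeroModeFloorDiluteGas

end
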